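import Summits.FinalStateConjecture.FinalStateConjecture.Theorems.EIHFluxBalanceInertialRecessionSlavingNullCovectorHessian

/-!
# Route EIHFluxBalance — `InertialRecession` (E′), K1 slaving: SECOND partials of the Kerr–Schild
# profile `H = M r³/(r⁴ + a² z²)` (general quotient-rule formula; tables at tangent and axis points)

Helper file for the crux `stmt-FinalStateConjecture-17403` (2-jet tables, part 3). From the closed form of
`∂_v H` (`…SlavingAxisData.fderiv_scalarH`, valid on `{r > 0}`) the quotient rule along `t ↦ y + t w` gives
`∂_w ∂_v H` in terms of `r, ∂_v r, ∂_w r, ∂_w∂_v r` and the coordinates (`fderiv_fderiv_scalarH`). Tables: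
at a tangent point `(t, x, a, 0)`: `∂₁₁H = 2M/x³`, `∂₁₂H = 3Ma/x⁴`, `∂₂₂H = M(3a² − x²)/x⁵`, `∂₃₃H = −M(x² + 3a²)/x⁵`,
`∂₁₃H = ∂₂₃H = 0`; at an axis point `(t, 0, 0, z)`, `z ≠ 0`: `∂₁₁H = ∂₂₂H = −M|z|(z² − 3a²)/(z² + a²)³`,
`∂₃₃H = 2M|z|(z² − 3a²)/(z² + a²)³`, off-diagonal entries `0` (so `H` is harmonic on the axis).
No definitions, no `sorry`. [folklore]
-/

set_option linter.dupNamespace false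

noncomputable section

open scoped Topology
open Filter Set Function Literature.Geometry.Lorentzian Literature.Geometry.Lorentzian.Kerr

namespace Summit.FinalStateConjecture.FinalStateConjecture.Theorems.SublinearIsFree.Slaving

section General

variable {a : ℝ} {y : E4} (hy : 0 < radius a y)
include hy

/-- `z ↦ ∂_v H(z)` is differentiable wherever `r > 0`. [folklore] -/
theorem differentiableAt_fderiv_scalarH_apply (M : ℝ) (v : E4) :
    DifferentiableAt ℝ (fun z ↦ fderiv ℝ (scalarH M a) z v) y := by
  have h2 : ContDiffAt ℝ 2 (scalarH M a) y := contDiffAt_scalarH M a hy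
  have h1 : ContDiffAt ℝ 1 (fderiv ℝ (scalarH M a)) y := h2.fderiv_right (m := 1) (by norm_num)
  exact ((ContinuousLinearMap.apply ℝ ℝ v).contDiff.contDiffAt.comp y h1).differentiableAt one_ne_zero

/-- **`∂_w∂_v H`** (quotient rule on the closed form of `∂_v H`): with `r_v = ∂_v r`, `r_w`, `r_vw = ∂_w∂_v r`,
`Q = r⁴ + a² z²`, `Q' = 4 r³ r_w + 2 a² z w³`, `N = M (3 r² r_v Q − r³ (4 r³ r_v + 2 a² z v³))`,
`∂_w∂_v H = (N' Q² − N · 2 Q Q')/Q⁴`. [folklore] -/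
theorem fderiv_fderiv_scalarH (M : ℝ) (v w : E4) :
    fderiv ℝ (fun z ↦ fderiv ℝ (scalarH M a) z v) y w =
      (M * ((3 * (2 * radius a y * fderiv ℝ (radius a) y w) * fderiv ℝ (radius a) y v +
                3 * radius a y ^ 2 * fderiv ℝ (fun z ↦ fderiv ℝ (radius a) z v) y w) *
              (radius a y ^ 4 + a ^ 2 * y 3 ^ 2) +
            3 * radius a y ^ 2 * fderiv ℝ (radius a) y v *
              (4 * radius a y ^ 3 * fderiv ℝ (radius a) y w + a ^ 2 * (2 * y 3 * w 3)) -
            (3 * radius a y ^ 2 * fderiv ℝ (radius a) y w *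
                (4 * radius a y ^ 3 * fderiv ℝ (radius a) y v + 2 * a ^ 2 * y 3 * v 3) +
              radius a y ^ 3 * (4 * (3 * radius a y ^ 2 * fderiv ℝ (radius a) y w) * fderiv ℝ (radius a) y v +
                4 * radius a y ^ 3 * fderiv ℝ (fun z ↦ fderiv ℝ (radius a) z v) y w +
                2 * a ^ 2 * w 3 * v 3))) *
            (radius a y ^ 4 + a ^ 2 * y 3 ^ 2) ^ 2 -
          M * (3 * radius a y ^ 2 * fderiv ℝ (radius a) y v * (radius a y ^ 4 + a ^ 2 * y 3 ^ 2) -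
              radius a y ^ 3 * (4 * radius a y ^ 3 * fderiv ℝ (radius a) y v + 2 * a ^ 2 * y 3 * v 3)) *
            (2 * (radius a y ^ 4 + a ^ 2 * y 3 ^ 2) *
              (4 * radius a y ^ 3 * fderiv ℝ (radius a) y w + a ^ 2 * (2 * y 3 * w 3)))) /
        ((radius a y ^ 4 + a ^ 2 * y 3 ^ 2) ^ 2) ^ 2 := by
  have hd := differentiableAt_fderiv_scalarH_apply hy M v
  refine (hd.hasFDerivAt.hasLineDerivAt w).unique ?_
  show HasDerivAt (fun t : ℝ ↦ fderiv ℝ (scalarH M a) (y + t • w) v) _ 0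
  have hfun : (fun t : ℝ ↦ fderiv ℝ (scalarH M a) (y + t • w) v) =ᶠ[𝓝 0]
      fun t ↦ M * (3 * radius a (y + t • w) ^ 2 * fderiv ℝ (radius a) (y + t • w) v *
            (radius a (y + t • w) ^ 4 + a ^ 2 * (y 3 + t * w 3) ^ 2) -
          radius a (y + t • w) ^ 3 * (4 * radius a (y + t • w) ^ 3 * fderiv ℝ (radius a) (y + t • w) v +
            2 * a ^ 2 * (y 3 + t * w 3) * v 3)) /
        (radius a (y + t • w) ^ 4 + a ^ 2 * (y 3 + t * w 3) ^ 2) ^ 2 := by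
    filter_upwards [eventually_radius_pos_line hy w] with t ht
    rw [fderiv_scalarH ht M v, add_smul_apply_E4]
  refine HasDerivAt.congr_of_eventuallyEq ?_ hfun
  have hr := hasDerivAt_radius_line hy w
  have hrv := hasDerivAt_fderiv_radius_line hy v w
  have hl3 := ((hasDerivAt_id (0 : ℝ)).mul_const (w 3)).const_add (y 3)
  have hQ := (hr.pow 4).add ((hl3.pow 2).const_mul (a ^ 2))
  have hA := (((hr.pow 2).const_mul 3).mul hrv).mul hQ
  have hB := (((hr.pow 3).const_mul 4).mul hrv).add ((hl3.const_mul (2 * a ^ 2)).mul_const (v 3))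
  have hN := ((hA.sub ((hr.pow 3).mul hB)).const_mul M)
  have hD := hQ.pow 2
  have hQ0 : radius a y ^ 4 + a ^ 2 * y 3 ^ 2 ≠ 0 := by positivity
  have hD0 : (radius a (y + (0 : ℝ) • w) ^ 4 + a ^ 2 * (y 3 + (0 : ℝ) * w 3) ^ 2) ^ 2 ≠ 0 := by
    simpa using pow_ne_zero 2 hQ0
  have hdiv := hN.div hD hD0
  refine hdiv.congr_deriv ?_
  simp only [Pi.pow_apply, Pi.mul_apply, Pi.sub_apply, Pi.add_apply, zero_smul, add_zero, zero_mul,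
    Nat.cast_ofNat, one_mul, pow_one, Nat.add_one_sub_one, id_eq]

end General

section Tangent

variable {a : ℝ} {y : E4} (h2 : y 2 = a) (h3 : y 3 = 0) (hx : 0 < y 1)
include h2 h3 hx

/-- **Tangent table for `∂²H`** at `(t, x, a, 0)`: `∂₁₁H = 2M/x³`, `∂₁₂H = ∂₂₁H = 3Ma/x⁴`,
`∂₂₂H = M(3a² − x²)/x⁵`, `∂₃₃H = −M(x² + 3a²)/x⁵`, `∂₁₃H = ∂₂₃H = 0`. [folklore] -/
theorem tangent_fderiv_fderiv_scalarH (M : ℝ) (i j : Fin 3) :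
    fderiv ℝ (fun z ↦ fderiv ℝ (scalarH M a) z (E4.basisVector i.succ)) y (E4.basisVector j.succ) =
      ![![2 * M / y 1 ^ 3, 3 * M * a / y 1 ^ 4, 0],
        ![3 * M * a / y 1 ^ 4, M * (3 * a ^ 2 - y 1 ^ 2) / y 1 ^ 5, 0],
        ![0, 0, -(M * (y 1 ^ 2 + 3 * a ^ 2) / y 1 ^ 5)]] i j := by
  have hr0 := tangent_radius_pos h2 h3 hx
  have hr := tangent_radius h2 h3 hx
  have hdr := tangent_fderiv_radius h2 h3 hx
  have hHr := tangent_fderiv_fderiv_radius h2 h3 hx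
  have hx0 : y 1 ≠ 0 := hx.ne'
  rw [fderiv_fderiv_scalarH hr0]
  simp only [hHr, hdr, hr, h3]
  fin_cases i <;> fin_cases j <;> simp [E4.basisVector] <;> field_simp <;> ring

end Tangent

section Axis

variable {a : ℝ} {y : E4} (h1 : y 1 = 0) (h2 : y 2 = 0) (hz : y 3 ≠ 0)
include h1 h2 hz

/-- **Axis table for `∂²H`** at `(t, 0, 0, z)`, `z ≠ 0`: `∂₁₁H = ∂₂₂H = −M|z|(z² − 3a²)/(z² + a²)³`,
`∂₃₃H = 2M|z|(z² − 3a²)/(z² + a²)³`, off-diagonal entries vanish (`H` is harmonic on the axis). [folklore] -/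
theorem axis_fderiv_fderiv_scalarH (M : ℝ) (i j : Fin 3) :
    fderiv ℝ (fun z ↦ fderiv ℝ (scalarH M a) z (E4.basisVector i.succ)) y (E4.basisVector j.succ) =
      ![![-(M * |y 3| * (y 3 ^ 2 - 3 * a ^ 2) / (y 3 ^ 2 + a ^ 2) ^ 3), 0, 0],
        ![0, -(M * |y 3| * (y 3 ^ 2 - 3 * a ^ 2) / (y 3 ^ 2 + a ^ 2) ^ 3), 0],
        ![0, 0, 2 * M * |y 3| * (y 3 ^ 2 - 3 * a ^ 2) / (y 3 ^ 2 + a ^ 2) ^ 3]] i j := by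
  have hr0 := axis_radius_pos (a := a) h1 h2 hz
  have hr := axis_radius (a := a) h1 h2
  have hdr := axis_fderiv_radius (a := a) h1 h2 hz
  have hHr := axis_fderiv_fderiv_radius (a := a) h1 h2 hz
  have hD : y 3 ^ 2 + a ^ 2 ≠ 0 := by positivity
  rw [fderiv_fderiv_scalarH hr0]
  rcases lt_or_gt_of_ne hz with hneg | hpos
  · have habs : |y 3| = -y 3 := abs_of_neg hneg
    have hone : y 3 / |y 3| = -1 := by rw [habs, div_neg, div_self hz]
    have hz' : -y 3 ≠ 0 := neg_ne_zero.2 hz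
    simp only [hone] at hdr
    simp only [hHr, hdr, hr, habs]
    fin_cases i <;> fin_cases j <;> simp [E4.basisVector] <;> field_simp <;> ring
  · have habs : |y 3| = y 3 := abs_of_pos hpos
    have hone : y 3 / |y 3| = 1 := by rw [habs, div_self hz]
    simp only [hone] at hdr
    simp only [hHr, hdr, hr, habs]
    fin_cases i <;> fin_cases j <;> simp [E4.basisVector] <;> field_simp <;> ring

end Axis

/-- Registered carrier `slaving_scalarHHessian_slaving12` of the crux item (= `tangent_fderiv_fderiv_scalarH`).
[folklore] -/
theorem slaving_scalarHHessian_slaving12 : open Literature.Geometry.Lorentzian in ∀ {M a : ℝ} {y : E4}, y 2 = a → y 3 = 0 → 0 < y 1 → ∀ i j : Fin 3, fderiv ℝ (fun z ↦ fderiv ℝ (Kerr.scalarH M a) z (E4.basisVector i.succ)) y (E4.basisVector j.succ) = ![![2 * M / y 1 ^ 3, 3 * M * a / y 1 ^ 4, 0], ![3 * M * a / y 1 ^ 4, M * (3 * a ^ 2 - y 1 ^ 2) / y 1 ^ 5, 0], ![0, 0, -(M * (y 1 ^ 2 + 3 * a ^ 2) / y 1 ^ 5)]] i j :=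
  fun {M} _ _ h2 h3 hx i j ↦ tangent_fderiv_fderiv_scalarH h2 h3 hx M i j

end Summit.FinalStateConjecture.FinalStateConjecture.Theorems.SublinearIsFree.Slaving
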